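import Mathlib
import Summits.ValiantsHypothesis.ValiantsHypothesis.Theorems.NewtonUnitEquationsNewtonTauWeakCornerDefs

/-!
# `NewtonTauWeak` (stmt-ValiantsHypothesis-5904), line `binomial-normal-form`, stub `fixedKCoincidence_t2_K3`:
# rays of an exponent list — primitive directions, the "no short 2-vs-1 relation" hypothesis, sign sets

Support file for the registered sub-stub `fixedKCoincidence_t2_K3` of the crux
`Summit.ValiantsHypothesis.ValiantsHypothesis.Theses.NewtonUnitEquations.NewtonTauWeak`.

Elementary lattice geometry of a common exponent list `d : Fin N → ℕ²`:
* `k2_direction_frame` (registered helper stub): the nonzero exponents group into `s ≤ N` RAYS with pairwise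
  distinct primitive generators `E₀_e ∈ ℕ² ∖ 0`, `d_j = g_j · pr_j` (`g_j ≥ 1`), parallel exponents have the same
  generator, and every lattice point of the line `ℝ d_j` is an integer multiple of `pr_j` (Bezout);
* `k2_no_escape`: the stub's hypothesis "no short 2-vs-1 relation" (verbatim) forbids, for oriented generators
  `E_e = ±E₀_e`, every relation `kE_e + tE_f = k'E_{e'}` with `e ≠ f`, `1 ≤ k ≤ M_e`, `1 ≤ t ≤ M_f` (`M_e` the total
  multiplicity of the ray) — the escape clauses of the local lemmas;
(The companion `…K3Signs.lean` shows that sign sets of real weights are nested threshold sets.)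

No definitions. [folklore]
-/

-- the namespace mandated for this Theorems file repeats the component `ValiantsHypothesis`
set_option linter.dupNamespace false

noncomputable section

open scoped BigOperators

namespace Summit.ValiantsHypothesis.ValiantsHypothesis.Theorems.NewtonTauWeakCorner

/-! ## §1 Primitive vectors -/

/-- Lattice points on the line through a coprime integer vector are its integer multiples (Bezout). [folklore] -/
theorem k2_exists_zsmul_of_coprime (a b : ℕ) (hab : Nat.Coprime a b) (z : Fin 2 → ℤ)
    (hz : z 0 * (b : ℤ) = z 1 * (a : ℤ)) : ∃ k : ℤ, z = k • ![(a : ℤ), (b : ℤ)] := by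
  obtain ⟨u, v, huv⟩ := Nat.isCoprime_iff_coprime.mpr hab
  refine ⟨u * z 0 + v * z 1, ?_⟩
  funext i
  fin_cases i
  · simp only [Fin.zero_eta, Fin.isValue, Pi.smul_apply, Matrix.cons_val_zero, smul_eq_mul]
    linear_combination (-(z 0)) * huv + v * hz
  · simp only [Fin.mk_one, Fin.isValue, Pi.smul_apply, Matrix.cons_val_one, Matrix.cons_val_fin_one,
      smul_eq_mul]
    linear_combination (-(z 1)) * huv - u * hz

/-- A nonzero exponent `d ∈ ℕ²` is `g · pr` with `g = gcd(d₀, d₁) ≥ 1` and `pr = d / g` coprime, non-negative,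
nonzero; lattice points of the line `ℝ d` are integer multiples of `pr`. [folklore] -/
theorem k2_primitive (d : Fin 2 →₀ ℕ) (hd : d ≠ 0) :
    1 ≤ Nat.gcd (d 0) (d 1) ∧
    (fun i => (d i : ℤ)) = (Nat.gcd (d 0) (d 1) : ℤ) • ![((d 0 / Nat.gcd (d 0) (d 1) : ℕ) : ℤ),
      ((d 1 / Nat.gcd (d 0) (d 1) : ℕ) : ℤ)] ∧
    (∀ i, (0 : ℤ) ≤ ![((d 0 / Nat.gcd (d 0) (d 1) : ℕ) : ℤ), ((d 1 / Nat.gcd (d 0) (d 1) : ℕ) : ℤ)] i) ∧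
    (![((d 0 / Nat.gcd (d 0) (d 1) : ℕ) : ℤ), ((d 1 / Nat.gcd (d 0) (d 1) : ℕ) : ℤ)] ≠ 0) ∧
    (∀ z : Fin 2 → ℤ, z 0 * (d 1 : ℤ) = z 1 * (d 0 : ℤ) →
      ∃ k : ℤ, z = k • ![((d 0 / Nat.gcd (d 0) (d 1) : ℕ) : ℤ), ((d 1 / Nat.gcd (d 0) (d 1) : ℕ) : ℤ)]) := by
  set g := Nat.gcd (d 0) (d 1) with hg
  have hd' : d 0 ≠ 0 ∨ d 1 ≠ 0 := by
    by_contra h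
    push Not at h
    apply hd
    ext i; fin_cases i
    · exact h.1
    · exact h.2
  have hgpos : 0 < g := by
    rcases hd' with h | h
    · exact Nat.gcd_pos_of_pos_left _ (Nat.pos_of_ne_zero h)
    · exact Nat.gcd_pos_of_pos_right _ (Nat.pos_of_ne_zero h)
  have h0 : d 0 = g * (d 0 / g) := (Nat.mul_div_cancel' (Nat.gcd_dvd_left _ _)).symm
  have h1 : d 1 = g * (d 1 / g) := (Nat.mul_div_cancel' (Nat.gcd_dvd_right _ _)).symm
  have hcop : Nat.Coprime (d 0 / g) (d 1 / g) := Nat.coprime_div_gcd_div_gcd hgpos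
  refine ⟨hgpos, ?_, ?_, ?_, ?_⟩
  · funext i
    fin_cases i
    · simp only [Fin.zero_eta, Fin.isValue, Pi.smul_apply, Matrix.cons_val_zero, smul_eq_mul]
      conv_lhs => rw [h0]
      push_cast; ring
    · simp only [Fin.mk_one, Fin.isValue, Pi.smul_apply, Matrix.cons_val_one, Matrix.cons_val_fin_one,
        smul_eq_mul]
      conv_lhs => rw [h1]
      push_cast; ring
  · intro i
    fin_cases i
    · exact Int.natCast_nonneg _
    · exact Int.natCast_nonneg _
  · intro h
    have e0 : ((d 0 / g : ℕ) : ℤ) = 0 := by simpa using congrFun h 0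
    have e1 : ((d 1 / g : ℕ) : ℤ) = 0 := by simpa using congrFun h 1
    have e0' : d 0 / g = 0 := by exact_mod_cast e0
    have e1' : d 1 / g = 0 := by exact_mod_cast e1
    rcases hd' with h' | h'
    · apply h'; rw [h0, e0', mul_zero]
    · apply h'; rw [h1, e1', mul_zero]
  · intro z hz
    apply k2_exists_zsmul_of_coprime _ _ hcop
    have hz' : (g : ℤ) * (z 0 * ((d 1 / g : ℕ) : ℤ)) = (g : ℤ) * (z 1 * ((d 0 / g : ℕ) : ℤ)) := by
      have e0 : (d 0 : ℤ) = (g : ℤ) * ((d 0 / g : ℕ) : ℤ) := by exact_mod_cast h0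
      have e1 : (d 1 : ℤ) = (g : ℤ) * ((d 1 / g : ℕ) : ℤ) := by exact_mod_cast h1
      rw [e0, e1] at hz
      linear_combination hz
    exact mul_left_cancel₀ (by exact_mod_cast hgpos.ne') hz'

/-- Parallel nonzero exponents of `ℕ²` have the same primitive vector. [folklore] -/
theorem k2_primitive_eq_of_parallel (d d' : Fin 2 →₀ ℕ) (hd : d ≠ 0) (hd' : d' ≠ 0)
    (hpar : (d 0 : ℤ) * (d' 1 : ℤ) = (d 1 : ℤ) * (d' 0 : ℤ)) :
    (![((d 0 / Nat.gcd (d 0) (d 1) : ℕ) : ℤ), ((d 1 / Nat.gcd (d 0) (d 1) : ℕ) : ℤ)] : Fin 2 → ℤ)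
      = ![((d' 0 / Nat.gcd (d' 0) (d' 1) : ℕ) : ℤ), ((d' 1 / Nat.gcd (d' 0) (d' 1) : ℕ) : ℤ)] := by
  obtain ⟨hg, hdec, hnn, hne, hline⟩ := k2_primitive d hd
  obtain ⟨hg', hdec', hnn', hne', hline'⟩ := k2_primitive d' hd'
  set pr : Fin 2 → ℤ := ![((d 0 / Nat.gcd (d 0) (d 1) : ℕ) : ℤ), ((d 1 / Nat.gcd (d 0) (d 1) : ℕ) : ℤ)] with hpr
  set pr' : Fin 2 → ℤ := ![((d' 0 / Nat.gcd (d' 0) (d' 1) : ℕ) : ℤ), ((d' 1 / Nat.gcd (d' 0) (d' 1) : ℕ) : ℤ)]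
    with hpr'
  set g : ℤ := (Nat.gcd (d 0) (d 1) : ℤ)
  set g' : ℤ := (Nat.gcd (d' 0) (d' 1) : ℤ)
  have hd0 : (d 0 : ℤ) = g * pr 0 := by have := congrFun hdec 0; simpa using this
  have hd1 : (d 1 : ℤ) = g * pr 1 := by have := congrFun hdec 1; simpa using this
  have hd0' : (d' 0 : ℤ) = g' * pr' 0 := by have := congrFun hdec' 0; simpa using this
  have hd1' : (d' 1 : ℤ) = g' * pr' 1 := by have := congrFun hdec' 1; simpa using this
  have hgpos : (0 : ℤ) < g := Int.natCast_pos.mpr hg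
  have hgpos' : (0 : ℤ) < g' := Int.natCast_pos.mpr hg'
  -- `pr'` lies on the line of `d`, and `pr` on the line of `d'`
  have hl1 : pr' 0 * (d 1 : ℤ) = pr' 1 * (d 0 : ℤ) := by
    have : g' * (pr' 0 * (d 1 : ℤ)) = g' * (pr' 1 * (d 0 : ℤ)) := by
      rw [hd0', hd1'] at hpar; linear_combination -hpar
    exact mul_left_cancel₀ hgpos'.ne' this
  have hl2 : pr 0 * (d' 1 : ℤ) = pr 1 * (d' 0 : ℤ) := by
    have : g * (pr 0 * (d' 1 : ℤ)) = g * (pr 1 * (d' 0 : ℤ)) := by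
      rw [hd0, hd1] at hpar; linear_combination hpar
    exact mul_left_cancel₀ hgpos.ne' this
  obtain ⟨k, hk⟩ := hline pr' hl1
  obtain ⟨k', hk'⟩ := hline' pr hl2
  -- `pr = k' k pr`, so `k' k = 1`
  have hkk : (k' * k) • pr = pr := by rw [mul_smul, ← hk, ← hk']
  have hpr0 : pr 0 ≠ 0 ∨ pr 1 ≠ 0 := by
    by_contra h; push Not at h
    apply hne; funext i; fin_cases i
    · exact h.1
    · exact h.2
  have hone : k' * k = 1 := by
    rcases hpr0 with h | h
    · have := congrFun hkk 0
      simp only [Pi.smul_apply, smul_eq_mul] at this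
      have : (k' * k - 1) * pr 0 = 0 := by linear_combination this
      rcases mul_eq_zero.mp this with h' | h'
      · linear_combination h'
      · exact absurd h' h
    · have := congrFun hkk 1
      simp only [Pi.smul_apply, smul_eq_mul] at this
      have : (k' * k - 1) * pr 1 = 0 := by linear_combination this
      rcases mul_eq_zero.mp this with h' | h'
      · linear_combination h'
      · exact absurd h' h
  rcases Int.eq_one_or_neg_one_of_mul_eq_one (by rw [mul_comm]; exact hone) with h1 | h1
  · rw [hk, h1, one_smul]
  · -- `pr' = -pr` contradicts non-negativity
    exfalso
    rw [h1] at hk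
    have hpr'0 : pr' 0 ≠ 0 ∨ pr' 1 ≠ 0 := by
      by_contra h; push Not at h
      apply hne'; funext i; fin_cases i
      · exact h.1
      · exact h.2
    rcases hpr'0 with h | h
    · have e := congrFun hk 0
      simp only [Pi.smul_apply, smul_eq_mul, neg_mul, one_mul] at e
      have a1 := hnn 0; have a2 := hnn' 0
      have : pr' 0 = 0 := by linarith
      exact h this
    · have e := congrFun hk 1
      simp only [Pi.smul_apply, smul_eq_mul, neg_mul, one_mul] at e
      have a1 := hnn 1; have a2 := hnn' 1
      have : pr' 1 = 0 := by linarith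
      exact h this

/-- **The direction frame of an exponent list (registered helper stub `k2_direction_frame`).** The nonzero
exponents of `d : Fin N → ℕ²` group into `s ≤ N` rays with pairwise distinct non-negative primitive generators
`E₀_e`; `d_j = g_j · pr_j` with `g_j ≥ 1` for `d_j ≠ 0`; the `pr_j` of nonzero exponents are exactly the `E₀_e`;
parallel nonzero exponents have equal `pr`; lattice points of the line `ℝ d_j` are integer multiples of `pr_j`.
[folklore] -/
theorem k2_direction_frame {N : ℕ} (d : Fin N → (Fin 2 →₀ ℕ)) :
    ∃ (s : ℕ) (E₀ : Fin s → Fin 2 → ℤ) (g : Fin N → ℕ) (pr : Fin N → Fin 2 → ℤ),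
      s ≤ N ∧ Function.Injective E₀ ∧ (∀ e i, 0 ≤ E₀ e i) ∧ (∀ e, E₀ e ≠ 0) ∧
      (∀ j, (fun i => (d j i : ℤ)) = (g j : ℤ) • pr j) ∧ (∀ j, d j ≠ 0 → 1 ≤ g j) ∧
      (∀ j, d j ≠ 0 → ∃ e, pr j = E₀ e) ∧ (∀ e, ∃ j, d j ≠ 0 ∧ pr j = E₀ e) ∧
      (∀ j j', d j ≠ 0 → d j' ≠ 0 → (d j 0 : ℤ) * (d j' 1 : ℤ) = (d j 1 : ℤ) * (d j' 0 : ℤ) → pr j = pr j') ∧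
      (∀ j (z : Fin 2 → ℤ), d j ≠ 0 → z 0 * (d j 1 : ℤ) = z 1 * (d j 0 : ℤ) → ∃ k : ℤ, z = k • pr j) := by
  classical
  set pr : Fin N → Fin 2 → ℤ := fun j =>
    ![((d j 0 / Nat.gcd (d j 0) (d j 1) : ℕ) : ℤ), ((d j 1 / Nat.gcd (d j 0) (d j 1) : ℕ) : ℤ)] with hpr
  set g : Fin N → ℕ := fun j => Nat.gcd (d j 0) (d j 1) with hg
  set Dir : Finset (Fin 2 → ℤ) := (Finset.univ.filter fun j => d j ≠ 0).image pr with hDir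
  set s := Dir.card with hs
  set E₀ : Fin s → Fin 2 → ℤ := fun e => (Dir.equivFin.symm e).1 with hE₀
  have hmemDir : ∀ e, E₀ e ∈ Dir := fun e => (Dir.equivFin.symm e).2
  have hDir_iff : ∀ y, y ∈ Dir ↔ ∃ j, d j ≠ 0 ∧ pr j = y := by
    intro y
    rw [hDir, Finset.mem_image]
    constructor
    · rintro ⟨j, hj, rfl⟩; exact ⟨j, (Finset.mem_filter.mp hj).2, rfl⟩
    · rintro ⟨j, hj, rfl⟩; exact ⟨j, Finset.mem_filter.mpr ⟨Finset.mem_univ j, hj⟩, rfl⟩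
  refine ⟨s, E₀, g, pr, ?_, ?_, ?_, ?_, ?_, ?_, ?_, ?_, ?_, ?_⟩
  · -- `s ≤ N`
    calc s = Dir.card := hs
      _ ≤ (Finset.univ.filter fun j => d j ≠ 0).card := Finset.card_image_le
      _ ≤ Finset.univ.card := Finset.card_le_univ _
      _ = N := by simp
  · intro e e' h
    have : Dir.equivFin.symm e = Dir.equivFin.symm e' := Subtype.ext h
    exact Dir.equivFin.symm.injective this
  · intro e i
    obtain ⟨j, hj, hje⟩ := (hDir_iff _).mp (hmemDir e)
    rw [← hje]
    exact (k2_primitive (d j) hj).2.2.1 i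
  · intro e
    obtain ⟨j, hj, hje⟩ := (hDir_iff _).mp (hmemDir e)
    rw [← hje]
    exact (k2_primitive (d j) hj).2.2.2.1
  · intro j
    by_cases hj : d j = 0
    · funext i
      simp [hpr, hg, hj]
    · exact (k2_primitive (d j) hj).2.1
  · intro j hj
    exact (k2_primitive (d j) hj).1
  · intro j hj
    have : pr j ∈ Dir := (hDir_iff _).mpr ⟨j, hj, rfl⟩
    refine ⟨Dir.equivFin ⟨pr j, this⟩, ?_⟩
    simp [hE₀]
  · intro e
    exact (hDir_iff _).mp (hmemDir e)
  · intro j j' hj hj' hpar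
    exact k2_primitive_eq_of_parallel (d j) (d j') hj hj' hpar
  · intro j z hj hz
    exact (k2_primitive (d j) hj).2.2.2.2 z hz

/-! ## §2 The "no short 2-vs-1 relation" hypothesis kills the escape clauses -/

/-- **No escape.** Under the stub's hypothesis (verbatim), with the direction frame of `k2_direction_frame`,
oriented generators `E_e = σ_e E₀_e` (`σ_e = ±1`) and ray multiplicities `M_e = Σ_{j on ray e} g_j`: no relation
`kE_e + tE_f = k'E_{e'}` with `e ≠ f`, `1 ≤ k ≤ M_e`, `1 ≤ t ≤ M_f`. [folklore] -/
theorem k2_no_escape {N s : ℕ} (d : Fin N → (Fin 2 →₀ ℕ)) (E₀ : Fin s → Fin 2 → ℤ) (g : Fin N → ℕ)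
    (pr : Fin N → Fin 2 → ℤ) (hinj : Function.Injective E₀) (hnn : ∀ e i, 0 ≤ E₀ e i) (hne0 : ∀ e, E₀ e ≠ 0)
    (hdec : ∀ j, (fun i => (d j i : ℤ)) = (g j : ℤ) • pr j)
    (hsurj : ∀ e, ∃ j, d j ≠ 0 ∧ pr j = E₀ e)
    (hpar : ∀ j j', d j ≠ 0 → d j' ≠ 0 → (d j 0 : ℤ) * (d j' 1 : ℤ) = (d j 1 : ℤ) * (d j' 0 : ℤ) → pr j = pr j')
    (σ : Fin s → ℤ) (hσ : ∀ e, σ e = 1 ∨ σ e = -1)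
    (H : ∀ (j₁ j₂ j₃ : Fin N) (z₁ z₂ : Fin 2 → ℤ), d j₁ ≠ 0 → d j₂ ≠ 0 → d j₃ ≠ 0 →
      (d j₁ 0 : ℤ) * (d j₂ 1 : ℤ) ≠ (d j₁ 1 : ℤ) * (d j₂ 0 : ℤ) → z₁ ≠ 0 →
      z₁ 0 * (d j₁ 1 : ℤ) = z₁ 1 * (d j₁ 0 : ℤ) →
      (∀ i, |z₁ i| ≤ ∑ j, if (d j 0 : ℤ) * (d j₁ 1 : ℤ) = (d j 1 : ℤ) * (d j₁ 0 : ℤ) then (d j i : ℤ) else 0) →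
      z₂ ≠ 0 → z₂ 0 * (d j₂ 1 : ℤ) = z₂ 1 * (d j₂ 0 : ℤ) →
      (∀ i, |z₂ i| ≤ ∑ j, if (d j 0 : ℤ) * (d j₂ 1 : ℤ) = (d j 1 : ℤ) * (d j₂ 0 : ℤ) then (d j i : ℤ) else 0) →
      (z₁ 0 + z₂ 0) * (d j₃ 1 : ℤ) ≠ (z₁ 1 + z₂ 1) * (d j₃ 0 : ℤ))
    (e f e' : Fin s) (hef : e ≠ f) (k t : ℕ) (k' : ℤ) (hk : 1 ≤ k)
    (hkM : k ≤ ∑ j ∈ Finset.univ.filter (fun j => d j ≠ 0 ∧ pr j = E₀ e), g j) (ht : 1 ≤ t)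
    (htM : t ≤ ∑ j ∈ Finset.univ.filter (fun j => d j ≠ 0 ∧ pr j = E₀ f), g j) :
    (k : ℤ) • (σ e • E₀ e) + (t : ℤ) • (σ f • E₀ f) ≠ k' • (σ e' • E₀ e') := by
  classical
  intro hrel
  obtain ⟨j₁, hj₁, hpr₁⟩ := hsurj e
  obtain ⟨j₂, hj₂, hpr₂⟩ := hsurj f
  obtain ⟨j₃, hj₃, hpr₃⟩ := hsurj e'
  -- coordinates of the `d`'s along their rays
  have hdc : ∀ j i, (d j i : ℤ) = (g j : ℤ) * pr j i := fun j i => by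
    have := congrFun (hdec j) i; simpa using this
  -- the in-range bound on a ray
  have hrange : ∀ (e : Fin s) (j₁ : Fin N), d j₁ ≠ 0 → pr j₁ = E₀ e → ∀ (k : ℕ),
      k ≤ ∑ j ∈ Finset.univ.filter (fun j => d j ≠ 0 ∧ pr j = E₀ e), g j → ∀ i,
      |((k : ℤ) • (σ e • E₀ e)) i| ≤
        ∑ j, if (d j 0 : ℤ) * (d j₁ 1 : ℤ) = (d j 1 : ℤ) * (d j₁ 0 : ℤ) then (d j i : ℤ) else 0 := by
    intro e j₁ hj₁ hpr₁ k hk i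
    have habs : |((k : ℤ) • (σ e • E₀ e)) i| = (k : ℤ) * E₀ e i := by
      simp only [Pi.smul_apply, smul_eq_mul]
      rw [abs_mul, abs_mul, abs_of_nonneg (hnn e i), abs_of_nonneg (by positivity : (0 : ℤ) ≤ k)]
      rcases hσ e with h | h <;> simp [h]
    rw [habs, ← Finset.sum_filter]
    -- the ray of `e` is inside the parallel class of `j₁`
    have hsub : Finset.univ.filter (fun j => d j ≠ 0 ∧ pr j = E₀ e)
        ⊆ Finset.univ.filter (fun j => (d j 0 : ℤ) * (d j₁ 1 : ℤ) = (d j 1 : ℤ) * (d j₁ 0 : ℤ)) := by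
      intro j hj
      obtain ⟨-, hj0, hprj⟩ := Finset.mem_filter.mp hj
      refine Finset.mem_filter.mpr ⟨Finset.mem_univ j, ?_⟩
      rw [hdc j 0, hdc j 1, hdc j₁ 0, hdc j₁ 1, hprj, hpr₁]; ring
    calc (k : ℤ) * E₀ e i ≤ (∑ j ∈ Finset.univ.filter (fun j => d j ≠ 0 ∧ pr j = E₀ e), (g j : ℤ)) * E₀ e i := by
          apply mul_le_mul_of_nonneg_right _ (hnn e i)
          exact_mod_cast hk
      _ = ∑ j ∈ Finset.univ.filter (fun j => d j ≠ 0 ∧ pr j = E₀ e), (d j i : ℤ) := by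
          rw [Finset.sum_mul]
          refine Finset.sum_congr rfl fun j hj => ?_
          obtain ⟨-, -, hprj⟩ := Finset.mem_filter.mp hj
          rw [hdc j i, hprj]
      _ ≤ ∑ j ∈ Finset.univ.filter (fun j => (d j 0 : ℤ) * (d j₁ 1 : ℤ) = (d j 1 : ℤ) * (d j₁ 0 : ℤ)),
            (d j i : ℤ) :=
          Finset.sum_le_sum_of_subset_of_nonneg hsub fun j _ _ => by positivity
  -- on-line conditions
  have honline : ∀ (e : Fin s) (j₁ : Fin N), pr j₁ = E₀ e → ∀ (c : ℤ),
      (c • (σ e • E₀ e)) 0 * (d j₁ 1 : ℤ) = (c • (σ e • E₀ e)) 1 * (d j₁ 0 : ℤ) := by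
    intro e j₁ hpr₁ c
    simp only [Pi.smul_apply, smul_eq_mul]
    rw [hdc j₁ 0, hdc j₁ 1, hpr₁]; ring
  have hz0 : ∀ (e : Fin s) (k : ℕ), 1 ≤ k → (k : ℤ) • (σ e • E₀ e) ≠ 0 := by
    intro e k hk h0
    apply hne0 e
    have hσ0 : σ e ≠ 0 := by rcases hσ e with h | h <;> simp [h]
    have hk0 : (k : ℤ) ≠ 0 := by exact_mod_cast (show k ≠ 0 by omega)
    rw [smul_smul] at h0
    exact (smul_eq_zero.mp h0).resolve_left (mul_ne_zero hk0 hσ0)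
  refine H j₁ j₂ j₃ ((k : ℤ) • (σ e • E₀ e)) ((t : ℤ) • (σ f • E₀ f)) hj₁ hj₂ hj₃ ?_ (hz0 e k hk)
    (honline e j₁ hpr₁ k) (hrange e j₁ hj₁ hpr₁ k hkM) (hz0 f t ht) (honline f j₂ hpr₂ t)
    (hrange f j₂ hj₂ hpr₂ t htM) ?_
  · -- the two rays are not parallel
    intro hp
    have := hpar j₁ j₂ hj₁ hj₂ hp
    rw [hpr₁, hpr₂] at this
    exact hef (hinj this)
  · -- the sum is on the line of `j₃`
    have h := congrFun hrel 0
    have h' := congrFun hrel 1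
    simp only [Pi.add_apply, Pi.smul_apply, smul_eq_mul] at h h' ⊢
    rw [h, h', hdc j₃ 0, hdc j₃ 1, hpr₃]
    ring

end Summit.ValiantsHypothesis.ValiantsHypothesis.Theorems.NewtonTauWeakCorner

end
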